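import Summits.QuantumAdvantage.QuantumAdvantage.Theses.CompactnessLift
import Summits.QuantumAdvantage.QuantumAdvantage.Theorems.CompactnessLiftLanguageLadderSummitStrength
import Literature.Computability.Complexity.RelativizedTime
import Literature.Computability.QuantumComplexity.BQTime

/-!
# Line `honest-split` for the crux `LanguageLadder` (stmt-QuantumAdvantage-15271, route CompactnessLift)

Registered by the crux-strategist (gen 1). This line is the DECOMPOSITION VEHICLE of the typed crux,
which is — by the tree theorem `languageLadder_iff_not_BQTime_two_subset_BPP` — exactly
`¬ (BQTIME(n²) ⊆ BPP)` (BC7: `crux.implies-summit`). Its two stubs are the two honestly typed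
statements the route was designed around (over `BPTime` = honest BPTIME(n^c): `O(n^c)` coins AND
time, `RelativizedTime.lean`), and `LanguageLadder_of` is their sorry-free composition:

* `stub_lift`   — the uniform-exponent lift (compactness principle on the quadratic window):
                  the RESEARCH stub; `↔ (ladder → LanguageLadder)`; kill test OracleDichotomy 15277;
* `stub_ladder` — the honest fixed-exponent ladder (refuter's repair C′ verbatim): HYPOTHESIS-TYPE
                  (implied by the crux; implies `PP ⊄ BPP` mod folklore) — drive ONLY its conditional
                  rungs (rSETH ⇒ rungs 0–3) and rung 0; never seat a worker on its tail (QA-A03).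

Both stubs are BC7-CLEAN against the summit and against the crux (probe output attached to the
item). The same two statements are filed as route items `UniformExponentLift` / `LanguageLadderR`;
closing those items closes these stubs verbatim. Card: `Lines/honest-split.md`.
-/

set_option linter.dupNamespace false

namespace Summit.QuantumAdvantage.QuantumAdvantage.Cruxes.LanguageLadder.HonestSplit

open Literature.Computability.Complexity Literature.Computability.QuantumComplexity
open Summit.QuantumAdvantage.QuantumAdvantage.Theses.CompactnessLift
open Summit.QuantumAdvantage.QuantumAdvantage.Theorems.CompactnessLiftLanguageLadder

/-- **stub_lift** — uniform-exponent lift on the quadratic window: if every quadratic-time-uniform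
Clifford+T language is in `BPP`, one exponent `c` puts them all in honest `BPTIME(n^c)`.
(= route item `UniformExponentLift`.) -/
theorem stub_lift :
    BQTime (fun n => n ^ 2) ⊆ BPP → ∃ c : ℕ, BQTime (fun n => n ^ 2) ⊆ BPTime (fun n => n ^ c) := by
  sorry

/-- **stub_ladder** — honest fixed-exponent ladder: for every `c` some quadratic-time-uniform
Clifford+T language outside honest `BPTIME(n^c)`. HYPOTHESIS-TYPE (= route item `LanguageLadderR`;
conditional rungs only). -/
theorem stub_ladder :
    ∀ c : ℕ, ∃ L ∈ BQTime (fun n => n ^ 2), L ∉ BPTime (fun n => n ^ c) := by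
  sorry

/-- **Composition (sorry-free)**: lift → ladder → the crux BY NAME. If every quadratic-uniform
quantum language were in `BPP`, the lift gives one exponent `c` and rung `c` of the ladder gives a
language outside `BPTIME(n^c)` — contradiction; and the crux is `¬ (BQTime (·^2) ⊆ BPP)`. [folklore] -/
theorem LanguageLadder_of :
    (BQTime (fun n => n ^ 2) ⊆ BPP → ∃ c : ℕ, BQTime (fun n => n ^ 2) ⊆ BPTime (fun n => n ^ c)) →
    (∀ c : ℕ, ∃ L ∈ BQTime (fun n => n ^ 2), L ∉ BPTime (fun n => n ^ c)) →
    Summit.QuantumAdvantage.QuantumAdvantage.Theses.CompactnessLift.LanguageLadder := by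
  intro h₁ h₂
  rw [languageLadder_iff_not_BQTime_two_subset_BPP]
  intro hsub
  obtain ⟨c, hc⟩ := h₁ hsub
  obtain ⟨L, hL, hLc⟩ := h₂ c
  exact hLc (hc hL)

/-- The crux from the stubs (what the lead's `--supports` landings assemble). -/
theorem LanguageLadder_proof :
    Summit.QuantumAdvantage.QuantumAdvantage.Theses.CompactnessLift.LanguageLadder :=
  LanguageLadder_of stub_lift stub_ladder

end Summit.QuantumAdvantage.QuantumAdvantage.Cruxes.LanguageLadder.HonestSplit
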